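import Summits.Ventures.CertifiedManyBodySolver.Rows.CorrWindowCertKernelChain
import HarnessLib

/-!
# The HINTED SYMMETRY-QUOTIENT chain step: slices canonicalised monomial by monomial with UNTRUSTED exporter hints,
# each accepted hint = one licensed affine-`D₄` move absorbed into the certificate's symmetry family

HONEST FRAMING: Lean plumbing towards «tier P». A certificate of the La214 programs is solved in ORBIT coordinates (variables =
words canonical under translations × box-`D₄`); replayed over RAW words (`Rows/CorrWindowCertKernelChain.lean`) it closes only if the
symmetry identifications it uses are supplied. This file lets them ride WITH THE SLICES as untrusted HINTS: for a monomial `m` of a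
slice's normal form the exporter proposes `(γ, v, μ)` — a `D₄` code, a shift, and an INNER monomial `μ` — and the kernel CHECKS
that the letters of `μ`, moved by `x ↦ γ·x + v` through the window's index tables and re-normal-ordered, give `±m`; on success the
term `c·m` is replaced by `(c/±1)·(μ pushed into the window)`, which changes the denoted operator by exactly one licensed-move term
`(c/±1)·(Γ(γ,v)(μ) − Γ(incl)(μ))`; a failing or absent hint changes nothing. So hints are never trusted, the accumulator lives in
canonical coordinates, and the closer (`affineOrbitLowerRowN_of_quotChainKernelCertTB`) builds the Literature theorem's symmetry
family from the ACCEPTED hints — the instance supplies NO symmetry data and proves NO per-move hypothesis (one table fact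
`hokV`/`hokS` about the finitely many licensed `(γ, v)` per geometry). Nothing of record moves; no claim node is discharged here;
CONTROL/CALIBRATION context (wording (xx1)); silent on the presence of superconductivity; not a `T_c` or phase sentence; nothing
about any material; no summit statement is proved by this file. Seat hubbard-obs-p2 (STIFFNESS), `prover-hubbard-obs-p2-g23-0`,
zero compute.

THE OBJECTS (outer letters `Orb (Fin N)` on the kernel window `Λ'` enumerated by `xs`/`ix`, inner letters `Orb (Fin Nβ)` on the
inner window `Λ` enumerated by `xsβ`, push `f`, validator `ok : Fin 8 → ℤ × ℤ → Bool` of licensed moves — bundled as `QuotData`):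
* `QHint Nβ = (γ : Fin 8, v : ℤ × ℤ, μ : Mono (Orb (Fin Nβ)))`; `d4OfCode`, `siteOfPair`; the index letter map
  `gq D γ v : Orb (Fin Nβ) → Orb (Fin N)`, `b ↦ orb (ix (γ·xsβ b + v)) (spin b)`;
* `hintRows` (target of each `ok` hint = the engine's normal form of the moved word, kept iff it is ONE signed monomial), `annotate`
  (structural merge-walk of the key-sorted slice normal form against the key-sorted hint rows; a match is RE-CHECKED structurally, so
  validity is local), `quotOut` / `quotMoves` (the quotiented term list and the accepted moves `(γ, v, Y := [(word μ, c/ε)])`),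
  `quotSlice`, `movesOf`, **`stepEQ D B C T H := mergeE B C (encPoly (normalize encL B (quotSlice D B T H)))`**;
* soundness `termOp_quotOut` / **`evalPoly_stepEQ`**: `decPoly N (stepEQ D B C T H)` denotes
  `decPoly N C + termOp d T − termOp d (symTL D.f (gq D) (movesOf D B T H))` for every injective `d` (NO geometry is used: the check is
  the engine's own `normalize` on one word, `evalPoly_normalize'`);
* `ChainQOK B M Cs Ts Hs` (per-step kernel facts with hint lists `Hs`) and `evalPoly_chainQ_nil`: the last accumulator denotes
  `termOp d Ts.flatten − termOp d (symTL … (allMoves D B Ts Hs M))`;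
* the geometry (the index letter map IS `Γ(incl) ∘ Γ(d4Emb γ v Λ)` on letters) and the CLOSER
  `affineOrbitLowerRowN_of_quotChainKernelCertTB` are in the companion `Rows/CorrWindowCertKernelChainQuotCloser.lean` (400-line rule).

References: X. Han, arXiv:2006.06002 §3 (symmetry reduction of the bootstrap: orbit variables) [Han2020Bootstrap]; J. Wang et al.,
PRX 14 (2024) 031006 §III [WangEtAl2024]; C. Jansson, D. Chaykin, C. Keil, SIAM J. Numer. Anal. 46 (2008) 180 [JanssonChaykinKeil2008];
O. Bratteli, D. W. Robinson, *Operator Algebras and Quantum Statistical Mechanics 2* §5.2.2 [BratteliRobinsonII1997].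
-/

namespace Summit.Ventures.CertifiedManyBodySolver

namespace CARPolyWindow

open Summit.Ventures.CertifiedQuantumChemistry Summit.Ventures.CertifiedQuantumChemistry.CARPoly
open Literature.MathematicalPhysics.QuantumLattice Literature.MathematicalPhysics.QuantumLattice.HubbardWave0
open Literature.MathematicalPhysics.QuantumManyBody.StateRelaxation
open Literature.Probability.LatticeModels ThermodynamicLimit Filter Topology
open Matrix
open scoped ComplexOrder BigOperators

/-! ## §1 Data and the computable step -/

section Data

variable {N Nβ : ℕ}

/-- An exporter HINT for one monomial of a slice's normal form: a `D₄` code `γ ∈ Fin 8` (`0–3` = rotations `r 0 … r 3`, `4–7` =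
reflections `sr 0 … sr 3`), an integer shift `v`, and the INNER monomial `μ` (creator indices, annihilator indices over the inner
window) whose move is claimed to be the monomial. Untrusted. [cite: Han2020Bootstrap, §3] -/
structure QHint (Nβ : ℕ) where
  /-- `D₄` code -/
  γ : Fin 8
  /-- shift -/
  v : ℤ × ℤ
  /-- inner monomial (canonical representative) -/
  μ : CARPoly.Mono (Orb (Fin Nβ))

/-- The index tables of a geometry: outer window sites `xs` with reader `ix`, inner window sites `xsβ`, the letter push `f` (inner →
outer), and the validator `ok` of licensed `(γ, v)`. [folklore] -/
structure QuotData (N Nβ : ℕ) where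
  /-- outer site enumeration -/
  xs : Fin N → Site 2
  /-- outer index reader -/
  ix : Site 2 → Fin N
  /-- inner site enumeration -/
  xsβ : Fin Nβ → Site 2
  /-- letter push inner → outer -/
  f : Orb (Fin Nβ) → Orb (Fin N)
  /-- licensed moves -/
  ok : Fin 8 → ℤ × ℤ → Bool

/-- The `D₄` element of a code. [folklore] -/
def d4OfCode (c : Fin 8) : DihedralGroup 4 :=
  match c.val with
  | 0 => DihedralGroup.r 0
  | 1 => DihedralGroup.r 1
  | 2 => DihedralGroup.r 2
  | 3 => DihedralGroup.r 3
  | 4 => DihedralGroup.sr 0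
  | 5 => DihedralGroup.sr 1
  | 6 => DihedralGroup.sr 2
  | _ => DihedralGroup.sr 3

/-- The site of an integer pair. [folklore] -/
def siteOfPair (p : ℤ × ℤ) : Site 2 := ![p.1, p.2]

/-- **The index letter map of the move `x ↦ γ·x + v`**: inner letter `(j, σ) ↦ (ix (γ·xsβ j + v), σ)`. [cite: Han2020Bootstrap, §3] -/
def gq (D : QuotData N Nβ) (γ : DihedralGroup 4) (v : Site 2) (b : Orb (Fin Nβ)) : Orb (Fin N) :=
  orb (D.ix (d4Vec γ (D.xsβ (ofLex b).1) + v)) (ofLex b).2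

/-- A monomial with its letters mapped. [folklore] -/
def mapMono {α β : Type*} (φ : β → α) (μ : CARPoly.Mono β) : CARPoly.Mono α := (μ.1.map φ, μ.2.map φ)

/-- The engine's normal form of the MOVED hint monomial (one word, coefficient `1`). [cite: BratteliRobinsonII1997, §5.2.2] -/
def hintTgt (D : QuotData N Nβ) (B : ℕ) (h : QHint Nβ) : CARPoly.Poly (Orb (Fin N)) :=
  CARPoly.normalize SOSDual.encL B [(Mono.word (mapMono (gq D (d4OfCode h.γ) (siteOfPair h.v)) h.μ), 1)]

/-- A hint row: `(key of the target monomial, target monomial, sign, hint)`. [folklore] -/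
abbrev HRow (N Nβ : ℕ) := ℕ × (CARPoly.Mono (Orb (Fin N)) × (ℚ × QHint Nβ))

/-- The rows of the licensed hints whose target is ONE signed monomial. [folklore] -/
def hintRows (D : QuotData N Nβ) (B : ℕ) (H : List (QHint Nβ)) : List (HRow N Nβ) :=
  H.filterMap fun h =>
    if D.ok h.γ h.v then
      match hintTgt D B h with
      | [(m, ε)] => some (Mono.key SOSDual.encL B m, (m, (ε, h)))
      | _ => none
    else none

/-- Drop the leading rows whose key is below `k`. [folklore] -/
def dropBehind (k : ℕ) : List (HRow N Nβ) → List (HRow N Nβ)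
  | [] => []
  | r :: R => if r.1 < k then dropBehind k R else r :: R

/-- The (local, re-checked) acceptance test of a row against a term. [folklore] -/
def rowOK (D : QuotData N Nβ) (B : ℕ) (m : CARPoly.Mono (Orb (Fin N))) (r : HRow N Nβ) : Bool :=
  decide (r.2.1 = m) && D.ok r.2.2.2.γ r.2.2.2.v && !decide (r.2.2.1 = 0) && decide (hintTgt D B r.2.2.2 = [(m, r.2.2.1)])

/-- An annotated term: the term and, if accepted, the sign and hint that canonicalise it. [folklore] -/
abbrev ATerm (N Nβ : ℕ) := (CARPoly.Mono (Orb (Fin N)) × ℚ) × Option (ℚ × QHint Nβ)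

/-- **The merge-walk**: annotate the (key-sorted) polynomial with accepted hints from the (key-sorted) rows; structural in the
polynomial; every acceptance is re-checked by `rowOK`. [folklore] -/
def annotate (D : QuotData N Nβ) (B : ℕ) : CARPoly.Poly (Orb (Fin N)) → List (HRow N Nβ) → List (ATerm N Nβ)
  | [], _ => []
  | t :: P, R =>
    match dropBehind (Mono.key SOSDual.encL B t.1) R with
    | [] => (t, none) :: annotate D B P []
    | r :: R' => if rowOK D B t.1 r then (t, some r.2.2) :: annotate D B P R' else (t, none) :: annotate D B P (r :: R')

/-- The quotiented term list: kept terms as words, accepted terms replaced by the PUSHED inner monomial with coefficient `c/ε`.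
[cite: Han2020Bootstrap, §3] -/
def quotOut (D : QuotData N Nβ) (A : List (ATerm N Nβ)) : Terms (Orb (Fin N)) :=
  A.map fun a => match a.2 with
    | none => (Mono.word a.1.1, a.1.2)
    | some e => (Mono.word (mapMono D.f e.2.μ), a.1.2 / e.1)

/-- The accepted moves `(γ code, shift, inner term list Y = [(word μ, c/ε)])`. [cite: Han2020Bootstrap, §3] -/
def quotMoves (A : List (ATerm N Nβ)) : List (Fin 8 × (ℤ × ℤ) × Terms (Orb (Fin Nβ))) :=
  A.filterMap fun a => a.2.map fun e => (e.2.γ, (e.2.v, [(Mono.word e.2.μ, a.1.2 / e.1)]))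

/-- The annotated normal form of a slice. [folklore] -/
def annSlice (D : QuotData N Nβ) (B : ℕ) (T : Terms (Orb (Fin N))) (H : List (QHint Nβ)) : List (ATerm N Nβ) :=
  annotate D B (CARPoly.normalize SOSDual.encL B T) (sortByKey (hintRows D B H))

/-- The quotiented slice (a term list, to be normal-ordered again). [cite: Han2020Bootstrap, §3] -/
def quotSlice (D : QuotData N Nβ) (B : ℕ) (T : Terms (Orb (Fin N))) (H : List (QHint Nβ)) : Terms (Orb (Fin N)) :=
  quotOut D (annSlice D B T H)

/-- The accepted moves of a slice. [cite: Han2020Bootstrap, §3] -/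
def movesOf (D : QuotData N Nβ) (B : ℕ) (T : Terms (Orb (Fin N))) (H : List (QHint Nβ)) :
    List (Fin 8 × (ℤ × ℤ) × Terms (Orb (Fin Nβ))) :=
  quotMoves (annSlice D B T H)

/-- **One HINTED QUOTIENT step of the encoded merge chain.** [cite: JanssonChaykinKeil2008, §3] [cite: Han2020Bootstrap, §3] -/
def stepEQ (D : QuotData N Nβ) (B : ℕ) (C : SOSDual.EncPoly) (T : Terms (Orb (Fin N))) (H : List (QHint Nβ)) : SOSDual.EncPoly :=
  SOSDual.mergeE B C (SOSDual.encPoly (CARPoly.normalize SOSDual.encL B (quotSlice D B T H)))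

/-- The symmetry term list of a LIST of moves: `Σ (Y moved by (γ, v)) − (Y pushed)`. [cite: Han2020Bootstrap, §3] -/
def symTL (f : Orb (Fin Nβ) → Orb (Fin N)) (g : DihedralGroup 4 → Site 2 → Orb (Fin Nβ) → Orb (Fin N))
    (L : List (Fin 8 × (ℤ × ℤ) × Terms (Orb (Fin Nβ)))) : Terms (Orb (Fin N)) :=
  L.flatMap fun mv => wmapT (g (d4OfCode mv.1) (siteOfPair mv.2.1)) mv.2.2 ++ negT (wmapT f mv.2.2)

/-- All accepted moves of the first `n` steps. [folklore] -/
def allMoves (D : QuotData N Nβ) (B : ℕ) (Ts : List (Terms (Orb (Fin N)))) (Hs : List (List (QHint Nβ))) :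
    ℕ → List (Fin 8 × (ℤ × ℤ) × Terms (Orb (Fin Nβ)))
  | 0 => []
  | n + 1 => allMoves D B Ts Hs n ++ movesOf D B (Ts.getD n []) (Hs.getD n [])

/-- No step, no move. [folklore] -/
theorem allMoves_zero (D : QuotData N Nβ) (B : ℕ) (Ts : List (Terms (Orb (Fin N)))) (Hs : List (List (QHint Nβ))) :
    allMoves D B Ts Hs 0 = [] := rfl

/-- The moves of `n + 1` steps. [folklore] -/
theorem allMoves_succ (D : QuotData N Nβ) (B : ℕ) (Ts : List (Terms (Orb (Fin N)))) (Hs : List (List (QHint Nβ))) (n : ℕ) :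
    allMoves D B Ts Hs (n + 1) = allMoves D B Ts Hs n ++ movesOf D B (Ts.getD n []) (Hs.getD n []) := rfl

end Data

/-! ## §2 Soundness of the step (no geometry) -/

section StepSound

variable {N Nβ : ℕ} {ι : Type*} [LinearOrder ι] [Fintype ι]

/-- `symTL` of no moves. [folklore] -/
theorem symTL_nil (f : Orb (Fin Nβ) → Orb (Fin N)) (g : DihedralGroup 4 → Site 2 → Orb (Fin Nβ) → Orb (Fin N)) :
    symTL f g [] = [] := rfl

/-- `symTL` of a cons. [folklore] -/
theorem symTL_cons (f : Orb (Fin Nβ) → Orb (Fin N)) (g : DihedralGroup 4 → Site 2 → Orb (Fin Nβ) → Orb (Fin N))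
    (mv : Fin 8 × (ℤ × ℤ) × Terms (Orb (Fin Nβ))) (L : List (Fin 8 × (ℤ × ℤ) × Terms (Orb (Fin Nβ)))) :
    symTL f g (mv :: L) = (wmapT (g (d4OfCode mv.1) (siteOfPair mv.2.1)) mv.2.2 ++ negT (wmapT f mv.2.2)) ++ symTL f g L := rfl

/-- `symTL` is additive in the move list. [folklore] -/
theorem symTL_append (f : Orb (Fin Nβ) → Orb (Fin N)) (g : DihedralGroup 4 → Site 2 → Orb (Fin Nβ) → Orb (Fin N))
    (L L' : List (Fin 8 × (ℤ × ℤ) × Terms (Orb (Fin Nβ)))) : symTL f g (L ++ L') = symTL f g L ++ symTL f g L' := by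
  simp [symTL, List.flatMap_append]

/-- Every acceptance recorded by `annotate` passed `rowOK`. [folklore] -/
theorem annotate_ok (D : QuotData N Nβ) (B : ℕ) : ∀ (P : CARPoly.Poly (Orb (Fin N))) (R : List (HRow N Nβ)),
    ∀ a ∈ annotate D B P R, ∀ e, a.2 = some e →
      D.ok e.2.γ e.2.v = true ∧ e.1 ≠ 0 ∧ hintTgt D B e.2 = [(a.1.1, e.1)]
  | [], R, a, ha, e, he => by simp [annotate] at ha
  | t :: P, R, a, ha, e, he => by
    rw [annotate] at ha
    split at ha
    · rcases List.mem_cons.1 ha with rfl | ha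
      · simp at he
      · exact annotate_ok D B P [] a ha e he
    · rename_i r R' hdrop
      split_ifs at ha with hok
      · rcases List.mem_cons.1 ha with rfl | ha
        · simp only [Option.some.injEq] at he
          subst he
          simp only [rowOK, Bool.and_eq_true, decide_eq_true_eq, Bool.not_eq_true', decide_eq_false_iff_not] at hok
          exact ⟨hok.1.1.2, hok.1.2, hok.2⟩
        · exact annotate_ok D B P R' a ha e he
      · rcases List.mem_cons.1 ha with rfl | ha
        · simp at he
        · exact annotate_ok D B P (r :: R') a ha e he

/-- The terms of `annotate` are the terms of the polynomial, in order. [folklore] -/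
theorem annotate_map_fst (D : QuotData N Nβ) (B : ℕ) : ∀ (P : CARPoly.Poly (Orb (Fin N))) (R : List (HRow N Nβ)),
    (annotate D B P R).map Prod.fst = P
  | [], R => by simp [annotate]
  | t :: P, R => by
    rw [annotate]
    split
    · rw [List.map_cons, annotate_map_fst D B P []]
    · rename_i r R' _
      split_ifs
      · rw [List.map_cons, annotate_map_fst D B P R']
      · rw [List.map_cons, annotate_map_fst D B P (r :: R')]

/-- `Mono.word` commutes with letter maps. [folklore] -/
theorem word_mapMono {α β : Type*} (φ : β → α) (μ : CARPoly.Mono β) :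
    Mono.word (mapMono φ μ) = (Mono.word μ).map fun l => (φ l.1, l.2) := by
  simp [Mono.word, mapMono, List.map_append, List.map_map, Function.comp_def]

/-- `wmap d (Mono.word μ)` is the word `evalMono` reads. [folklore] -/
theorem ladderWord_wmap_word (d : Orb (Fin N) → ι) (μ : CARPoly.Mono (Orb (Fin N))) :
    ladderWord (wmap d (Mono.word μ)) = evalMono d μ := rfl

/-- An accepted hint's IDENTITY: the moved inner word denotes `ε •` the target monomial. [cite: BratteliRobinsonII1997, §5.2.2] -/
theorem ladderWord_moved_of_hintTgt {d : Orb (Fin N) → ι} (hd : Function.Injective d) (D : QuotData N Nβ) (B : ℕ)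
    (h : QHint Nβ) (m : CARPoly.Mono (Orb (Fin N))) (ε : ℚ) (htgt : hintTgt D B h = [(m, ε)]) :
    ladderWord (wmap d (Mono.word (mapMono (gq D (d4OfCode h.γ) (siteOfPair h.v)) h.μ))) = ((ε : ℚ) : ℂ) • evalMono d m := by
  have e := evalPoly_normalize' hd SOSDual.encL B [(Mono.word (mapMono (gq D (d4OfCode h.γ) (siteOfPair h.v)) h.μ), (1 : ℚ))]
  rw [← hintTgt, htgt, evalPoly_cons, evalPoly_nil, add_zero, termOp_cons, termOp_nil, add_zero, Rat.cast_one, one_smul] at e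
  exact e.symm

/-- **Soundness of the quotient of an annotated list**: the quotiented terms denote the annotated polynomial MINUS the symmetry list
of the accepted moves — for ANY annotation whose acceptances pass the hint identity. [cite: Han2020Bootstrap, §3] -/
theorem termOp_quotOut {d : Orb (Fin N) → ι} (hd : Function.Injective d) (D : QuotData N Nβ) (B : ℕ) :
    ∀ (A : List (ATerm N Nβ)),
      (∀ a ∈ A, ∀ e, a.2 = some e → D.ok e.2.γ e.2.v = true ∧ e.1 ≠ 0 ∧ hintTgt D B e.2 = [(a.1.1, e.1)]) →
      termOp d (quotOut D A) = evalPoly d (A.map Prod.fst) - termOp d (symTL D.f (gq D) (quotMoves A))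
  | [], _ => by simp [quotOut, quotMoves, symTL]
  | a :: A, hA => by
    have ih := termOp_quotOut hd D B A fun a' ha' => hA a' (List.mem_cons_of_mem _ ha')
    obtain ⟨⟨m, c⟩, o⟩ := a
    cases o with
    | none =>
      have hq : quotOut D ((((m, c), none) : ATerm N Nβ) :: A) = (Mono.word m, c) :: quotOut D A := rfl
      have hm : quotMoves ((((m, c), none) : ATerm N Nβ) :: A) = quotMoves A := rfl
      rw [hq, hm, termOp_cons, ih, List.map_cons, evalPoly_cons, ladderWord_wmap_word]
      abel
    | some e =>
      obtain ⟨hok, hε, htgt⟩ := hA ((m, c), some e) (List.mem_cons_self) e rfl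
      have hq : quotOut D ((((m, c), some e) : ATerm N Nβ) :: A) = (Mono.word (mapMono D.f e.2.μ), c / e.1) :: quotOut D A := rfl
      have hm : quotMoves ((((m, c), some e) : ATerm N Nβ) :: A) =
          (e.2.γ, (e.2.v, [(Mono.word e.2.μ, c / e.1)])) :: quotMoves A := rfl
      rw [hq, hm, termOp_cons, ih, List.map_cons, evalPoly_cons, symTL_cons, termOp_append, termOp_append, termOp_negT]
      dsimp only
      have hmv : termOp d (wmapT (gq D (d4OfCode e.2.γ) (siteOfPair e.2.v)) [(Mono.word e.2.μ, c / e.1)]) =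
          (((c / e.1 : ℚ)) : ℂ) • (((e.1 : ℚ) : ℂ) • evalMono d m) := by
        show termOp d [((Mono.word e.2.μ).map (fun l => (gq D (d4OfCode e.2.γ) (siteOfPair e.2.v) l.1, l.2)), c / e.1)] = _
        rw [termOp_cons, termOp_nil, add_zero, ← word_mapMono, ladderWord_moved_of_hintTgt hd D B e.2 m e.1 htgt]
      have hpl : termOp d (wmapT D.f [(Mono.word e.2.μ, c / e.1)]) =
          (((c / e.1 : ℚ)) : ℂ) • ladderWord (wmap d (Mono.word (mapMono D.f e.2.μ))) := by
        show termOp d [((Mono.word e.2.μ).map (fun l => (D.f l.1, l.2)), c / e.1)] = _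
        rw [termOp_cons, termOp_nil, add_zero, ← word_mapMono]
      rw [hmv, hpl, smul_smul, ← Rat.cast_mul, div_mul_cancel₀ c hε]
      abel

/-- **Soundness of the quotiented slice.** [cite: Han2020Bootstrap, §3] -/
theorem termOp_quotSlice {d : Orb (Fin N) → ι} (hd : Function.Injective d) (D : QuotData N Nβ) (B : ℕ)
    (T : Terms (Orb (Fin N))) (H : List (QHint Nβ)) :
    termOp d (quotSlice D B T H) = termOp d T - termOp d (symTL D.f (gq D) (movesOf D B T H)) := by
  rw [quotSlice, movesOf, annSlice, termOp_quotOut hd D B _ (annotate_ok D B _ _), annotate_map_fst, evalPoly_normalize' hd]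

variable [NeZero N]

/-- **Soundness of one hinted quotient step**: for an injective letter map, `decPoly N (stepEQ D B C T H)` denotes
`decPoly N C + termOp d T − termOp d (symTL … (movesOf D B T H))`. [cite: JanssonChaykinKeil2008, §3] [cite: Han2020Bootstrap, §3] -/
theorem evalPoly_stepEQ {d : Orb (Fin N) → ι} (hd : Function.Injective d) (D : QuotData N Nβ) (B : ℕ) (C : SOSDual.EncPoly)
    (T : Terms (Orb (Fin N))) (H : List (QHint Nβ)) :
    evalPoly d (SOSDual.decPoly N (stepEQ D B C T H)) =
      evalPoly d (SOSDual.decPoly N C) + termOp d T - termOp d (symTL D.f (gq D) (movesOf D B T H)) := by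
  rw [stepEQ, evalPoly_decPoly_mergeE', SOSDual.decPoly_encPoly, evalPoly_normalize' hd, termOp_quotSlice hd, add_sub_assoc]

end StepSound

/-! ## §3 Chains of hinted steps -/

section ChainQ

variable {N Nβ : ℕ}

/-- **The per-step kernel facts of a hinted staged replay**: `M` slices; accumulator `i+1` IS the hinted step of accumulator `i`
with slice `i` and hint list `i`. [cite: JanssonChaykinKeil2008, §3] -/
structure ChainQOK (D : QuotData N Nβ) (B M : ℕ) (Cs : List SOSDual.EncPoly) (Ts : List (Terms (Orb (Fin N))))
    (Hs : List (List (QHint Nβ))) : Prop where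
  /-- the slice list has exactly `M` entries -/
  len : Ts.length = M
  /-- step `i` -/
  step : ∀ i : Fin M, Cs.getD (i.val + 1) [] = stepEQ D B (Cs.getD i.val []) (Ts.getD i.val []) (Hs.getD i.val [])

variable [NeZero N] {ι : Type*} [LinearOrder ι] [Fintype ι]

/-- The hinted chain invariant after `n ≤ M` steps. [folklore] -/
theorem evalPoly_chainQ_take {d : Orb (Fin N) → ι} (hd : Function.Injective d) {D : QuotData N Nβ} {B M : ℕ}
    {Cs : List SOSDual.EncPoly} {Ts : List (Terms (Orb (Fin N)))} {Hs : List (List (QHint Nβ))} (h : ChainQOK D B M Cs Ts Hs) :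
    ∀ n, n ≤ M → evalPoly d (SOSDual.decPoly N (Cs.getD n [])) =
      evalPoly d (SOSDual.decPoly N (Cs.getD 0 [])) + termOp d (Ts.take n).flatten -
        termOp d (symTL D.f (gq D) (allMoves D B Ts Hs n))
  | 0, _ => by rw [List.take_zero, List.flatten_nil, termOp_nil, add_zero, allMoves_zero, symTL_nil, termOp_nil, sub_zero]
  | n + 1, hn => by
    have hlt : n < Ts.length := by rw [h.len]; omega
    have ih := evalPoly_chainQ_take hd h n (by omega)
    rw [h.step ⟨n, by omega⟩, evalPoly_stepEQ hd, ih, allMoves_succ, symTL_append, termOp_append,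
      List.take_succ_eq_append_getElem hlt, List.flatten_append, List.flatten_singleton, termOp_append,
      List.getD_eq_getElem _ _ hlt]
    generalize evalPoly d (SOSDual.decPoly N (Cs.getD 0 [])) = E0
    generalize termOp d (List.take n Ts).flatten = Tn
    generalize termOp d Ts[n] = t
    generalize termOp d (symTL D.f (gq D) (allMoves D B Ts Hs n)) = Sn
    generalize termOp d (symTL D.f (gq D) (movesOf D B Ts[n] (Hs.getD n []))) = sn
    abel

/-- **Soundness of a hinted chain from the empty accumulator**: the last accumulator denotes all slices minus the symmetry list of
ALL accepted moves. [cite: JanssonChaykinKeil2008, §3] [cite: Han2020Bootstrap, §3] -/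
theorem evalPoly_chainQ_nil {d : Orb (Fin N) → ι} (hd : Function.Injective d) {D : QuotData N Nβ} {B M : ℕ}
    {Cs : List SOSDual.EncPoly} {Ts : List (Terms (Orb (Fin N)))} {Hs : List (List (QHint Nβ))} (hC0 : Cs.getD 0 [] = [])
    (h : ChainQOK D B M Cs Ts Hs) :
    evalPoly d (SOSDual.decPoly N (Cs.getD M [])) =
      termOp d Ts.flatten - termOp d (symTL D.f (gq D) (allMoves D B Ts Hs M)) := by
  have e := evalPoly_chainQ_take hd h M le_rfl
  rwa [List.take_of_length_le h.len.le, hC0, evalPoly_decPoly_nil, zero_add] at e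

end ChainQ

end CARPolyWindow

end Summit.Ventures.CertifiedManyBodySolver
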